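import Summits.Ventures.HodgeRepro2.T5SU11LegendreSecondKind
import Summits.Ventures.HodgeRepro2.T5SU11LegendreMoments
import Mathlib.Analysis.SpecificLimits.Normed

/-!
# The series of `Q_n` in `1/x`: `Q_n(x) = ½ Σ_{k≥n} x^{−k−1} ∫ t^k P_n(t) dt`, positivity, and the asymptotic
`x^{n+1} Q_n(x) → 1/((2n + 1) lc_n)`

For `x > 1` the kernel of Neumann's integral expands as the geometric series `1/(x − t) = Σ_k t^k/x^{k+1}`
(`|t/x| < 1` on `[−1, 1]`), dominated by the summable `1/x^{k+1}`, so the integral and the sum commute: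

  **`Q_n(x) = Σ_k ½ x^{−(k+1)} ∫_{−1}^{1} t^k P_n(t) dt`**   (`hasSum_legQ2`).

The moments vanish for `k < n` and are non-negative for `k ≥ n` (row 437), and the `k = n` term is
`½ x^{−(n+1)} · 2/((2n + 1) lc_n) > 0`, hence **`Q_n(x) > 0` for every `x > 1`** (`legQ2_pos`) and, since the tail
`Σ_{k>n}` is at most `Σ_{j≥1} x^{−j} = 1/(x − 1)` times `x^{−(n+1)}` (`|∫ t^k P_n| ≤ 2`),

  **`x^{n+1} Q_n(x) → 1/((2n + 1) lc_n) = 2ⁿ (n!)²/(2n + 1)!` as `x → ∞`**   (`tendsto_pow_mul_legQ2`):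

the Legendre function of the second kind decays exactly like `x^{−n−1}`, with the classical constant. Nothing is
claimed about (N).

Blind lane: Mathlib + the HodgeRepro2 prefix only; no sorry; axioms ⊆ {propext, Classical.choice,
Quot.sound}.
-/

namespace Summit.Ventures.HodgeRepro2.T5SU11LegendreSecondKindSeries

open Polynomial intervalIntegral Finset Filter Topology MeasureTheory
open Set (Icc Ioi Ioo uIcc uIoc)
open T5SU11SphericalLegendreAll T5SU11JacobiLegendreLeading T5SU11LegendreIdentities T5SU11LegendreBound
  T5SU11LegendreSecondKind T5SU11LegendreMoments

/-! ### The geometric expansion of the kernel -/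

/-- **`1/(x − t) = Σ_k t^k/x^{k+1}`** for `|t| < x`. -/
theorem hasSum_kernel {x t : ℝ} (h : |t| < x) : HasSum (fun k : ℕ => t ^ k / x ^ (k + 1)) (1 / (x - t)) := by
  have hx : 0 < x := lt_of_le_of_lt (abs_nonneg t) h
  have hr : |t / x| < 1 := by
    rw [abs_div, abs_of_pos hx, div_lt_one hx]
    exact h
  have hg := (hasSum_geometric_of_abs_lt_one hr).mul_left (1 / x)
  have e : ∀ k : ℕ, 1 / x * (t / x) ^ k = t ^ k / x ^ (k + 1) := fun k => by
    rw [div_pow, pow_succ]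
    field_simp
  have e2 : 1 / x * (1 - t / x)⁻¹ = 1 / (x - t) := by
    have : x - t ≠ 0 := by
      have := (abs_lt.mp h).2
      linarith
    field_simp
  simp_rw [e] at hg
  rwa [e2] at hg

/-- **The series of Neumann's integral**: `Q_n(x) = Σ_k ½ x^{−(k+1)} ∫ t^k P_n` for `x > 1` (dominated convergence
with the geometric majorant `x^{−(k+1)}`). -/
theorem hasSum_legQ2 (n : ℕ) {x : ℝ} (hx : 1 < x) :
    HasSum (fun k : ℕ => (1 / 2) * (1 / x ^ (k + 1)) * ∫ t in (-1 : ℝ)..1, t ^ k * legP n t) (legQ2 n x) := by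
  have hxpos : 0 < x := by linarith
  have hsub : uIoc (-1 : ℝ) 1 ⊆ Icc (-1 : ℝ) 1 := by
    rw [Set.uIoc_of_le (by norm_num)]
    exact Set.Ioc_subset_Icc_self
  have hmaj : Summable (fun k : ℕ => 1 / x ^ (k + 1)) := by
    have := (summable_geometric_of_lt_one (by positivity : (0 : ℝ) ≤ 1 / x) (by rwa [div_lt_one hxpos])).mul_left (1 / x)
    refine this.congr fun k => ?_
    rw [div_pow, one_pow, pow_succ]
    field_simp
  have h := intervalIntegral.hasSum_integral_of_dominated_convergence (μ := volume) (a := (-1 : ℝ)) (b := 1)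
    (F := fun k t => t ^ k / x ^ (k + 1) * legP n t) (f := fun t => legP n t / (x - t))
    (fun k _ => 1 / x ^ (k + 1))
    (fun k => ((continuous_pow k).div_const _ |>.mul (continuous_legP n)).aestronglyMeasurable)
    (fun k => Filter.Eventually.of_forall fun t ht => by
      have ht' : t ∈ Icc (-1 : ℝ) 1 := hsub ht
      have htabs : |t| ≤ 1 := abs_le.mpr ⟨ht'.1, ht'.2⟩
      rw [Real.norm_eq_abs, abs_mul, abs_div, abs_pow, abs_of_pos (pow_pos hxpos _)]
      calc |t| ^ k / x ^ (k + 1) * |legP n t| ≤ 1 ^ k / x ^ (k + 1) * 1 := by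
            gcongr
            · exact abs_legP_le_one n ht'
        _ = 1 / x ^ (k + 1) := by rw [one_pow, mul_one])
    (Filter.Eventually.of_forall fun _ _ => hmaj)
    intervalIntegrable_const
    (Filter.Eventually.of_forall fun t ht => by
      have ht' : t ∈ Icc (-1 : ℝ) 1 := hsub ht
      have htabs : |t| < x := lt_of_le_of_lt (abs_le.mpr ⟨ht'.1, ht'.2⟩) hx
      have := (hasSum_kernel htabs).mul_right (legP n t)
      have e : 1 / (x - t) * legP n t = legP n t / (x - t) := by ring
      rw [e] at this
      refine this.congr_fun fun k => ?_
      ring)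
  have h2 := h.mul_left (1 / 2)
  unfold legQ2
  refine h2.congr_fun fun k => ?_
  rw [← intervalIntegral.integral_const_mul, ← intervalIntegral.integral_const_mul]
  exact integral_congr fun t _ => by ring

/-! ### Positivity and the asymptotic -/

/-- Every term of the series is non-negative (`x > 1`). -/
theorem term_nonneg (n : ℕ) {x : ℝ} (hx : 1 < x) (k : ℕ) :
    0 ≤ (1 / 2) * (1 / x ^ (k + 1)) * ∫ t in (-1 : ℝ)..1, t ^ k * legP n t := by
  have hxpos : 0 < x := by linarith
  rcases Nat.lt_or_ge k n with hk | hk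
  · rw [integral_pow_mul_legP_eq_zero_of_lt hk, mul_zero]
  · exact mul_nonneg (by positivity) (integral_pow_mul_legP_nonneg hk)

/-- **`Q_n(x) > 0` for every `x > 1`**: the `k = n` term is positive and the others are non-negative. -/
theorem legQ2_pos (n : ℕ) {x : ℝ} (hx : 1 < x) : 0 < legQ2 n x := by
  have hxpos : 0 < x := by linarith
  have hL := legLead_pos n
  have hterm : 0 < (1 / 2) * (1 / x ^ (n + 1)) * ∫ t in (-1 : ℝ)..1, t ^ n * legP n t := by
    rw [integral_pow_self_mul_legP]
    positivity
  exact lt_of_lt_of_le hterm (le_hasSum (hasSum_legQ2 n hx) n fun j _ => term_nonneg n hx j)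

/-- The terms with `k < n` vanish, so `Q_n(x) = Σ_j ½ x^{−(n+j+1)} ∫ t^{n+j} P_n` (`x > 1`). -/
theorem hasSum_legQ2_shift (n : ℕ) {x : ℝ} (hx : 1 < x) :
    HasSum (fun j : ℕ => (1 / 2) * (1 / x ^ (j + n + 1)) * ∫ t in (-1 : ℝ)..1, t ^ (j + n) * legP n t)
      (legQ2 n x) := by
  have h := hasSum_legQ2 n hx
  have h0 : ∑ k ∈ range n, (1 / 2) * (1 / x ^ (k + 1)) * ∫ t in (-1 : ℝ)..1, t ^ k * legP n t = 0 :=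
    Finset.sum_eq_zero fun k hk => by
      rw [integral_pow_mul_legP_eq_zero_of_lt (Finset.mem_range.mp hk), mul_zero]
  have := (hasSum_nat_add_iff' n).mpr h
  rw [h0, sub_zero] at this
  exact this.congr_fun fun j => rfl

/-- **`|x^{n+1} Q_n(x) − 1/((2n + 1) lc_n)| ≤ 1/(x − 1)`** for `x > 1`: the tail of the series is bounded by
`Σ_{j≥1} x^{−j}`. -/
theorem abs_pow_mul_legQ2_sub_le (n : ℕ) {x : ℝ} (hx : 1 < x) :
    |x ^ (n + 1) * legQ2 n x - 1 / ((2 * (n : ℝ) + 1) * legLead n)| ≤ 1 / (x - 1) := by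
  have hxpos : 0 < x := by linarith
  have hL := legLead_pos n
  have h := (hasSum_legQ2_shift n hx).mul_left (x ^ (n + 1))
  -- the `j = 0` term is `1/((2n + 1) lc_n)`, the rest is the tail
  have h1 := (hasSum_nat_add_iff' 1).mpr h
  simp only [Finset.sum_range_one, zero_add] at h1
  have e0 : x ^ (n + 1) * ((1 / 2) * (1 / x ^ (n + 1)) * ∫ t in (-1 : ℝ)..1, t ^ n * legP n t)
      = 1 / ((2 * (n : ℝ) + 1) * legLead n) := by
    rw [integral_pow_self_mul_legP]
    field_simp
  rw [e0] at h1
  -- `0 ≤ tail ≤ Σ_{j≥0} x^{−(j+1)} = 1/(x − 1)`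
  have hgeom : HasSum (fun j : ℕ => 1 / x ^ (j + 1)) (1 / (x - 1)) := by
    have hr : |1 / x| < 1 := by
      rw [abs_of_pos (by positivity), div_lt_one hxpos]
      exact hx
    have := (hasSum_geometric_of_abs_lt_one hr).mul_left (1 / x)
    have e : ∀ j : ℕ, 1 / x * (1 / x) ^ j = 1 / x ^ (j + 1) := fun j => by
      rw [div_pow, one_pow, pow_succ]
      field_simp
    have e2 : 1 / x * (1 - 1 / x)⁻¹ = 1 / (x - 1) := by
      have : x - 1 ≠ 0 := by linarith
      field_simp
    simp_rw [e] at this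
    rwa [e2] at this
  have hterm_le : ∀ j : ℕ, x ^ (n + 1) * ((1 / 2) * (1 / x ^ (j + 1 + n + 1))
      * ∫ t in (-1 : ℝ)..1, t ^ (j + 1 + n) * legP n t) ≤ 1 / x ^ (j + 1) := by
    intro j
    have hb : |∫ t in (-1 : ℝ)..1, t ^ (j + 1 + n) * legP n t| ≤ 2 := by
      have := intervalIntegral.norm_integral_le_of_norm_le_const (a := (-1 : ℝ)) (b := 1) (C := 1)
        (f := fun t => t ^ (j + 1 + n) * legP n t) fun t ht => by
          have ht' : t ∈ Icc (-1 : ℝ) 1 := by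
            rw [Set.uIoc_of_le (by norm_num)] at ht
            exact Set.Ioc_subset_Icc_self ht
          have htabs : |t| ≤ 1 := abs_le.mpr ⟨ht'.1, ht'.2⟩
          rw [Real.norm_eq_abs, abs_mul, abs_pow]
          calc |t| ^ (j + 1 + n) * |legP n t| ≤ 1 ^ (j + 1 + n) * 1 :=
                mul_le_mul (pow_le_pow_left₀ (abs_nonneg _) htabs _) (abs_legP_le_one n ht') (abs_nonneg _)
                  (by norm_num)
            _ = 1 := by rw [one_pow, mul_one]
      rw [Real.norm_eq_abs] at this
      norm_num at this
      linarith
    have hI := (abs_le.mp hb).2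
    have hpow : x ^ (j + 1 + n + 1) = x ^ (n + 1) * x ^ (j + 1) := by ring
    rw [hpow]
    have hxn : 0 < x ^ (n + 1) := pow_pos hxpos _
    have hxj : 0 < x ^ (j + 1) := pow_pos hxpos _
    calc x ^ (n + 1) * ((1 / 2) * (1 / (x ^ (n + 1) * x ^ (j + 1)))
          * ∫ t in (-1 : ℝ)..1, t ^ (j + 1 + n) * legP n t)
        = (1 / 2) * (1 / x ^ (j + 1)) * ∫ t in (-1 : ℝ)..1, t ^ (j + 1 + n) * legP n t := by
          field_simp
      _ ≤ (1 / 2) * (1 / x ^ (j + 1)) * 2 := by gcongr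
      _ = 1 / x ^ (j + 1) := by ring
  have hterm_nonneg : ∀ j : ℕ, 0 ≤ x ^ (n + 1) * ((1 / 2) * (1 / x ^ (j + 1 + n + 1))
      * ∫ t in (-1 : ℝ)..1, t ^ (j + 1 + n) * legP n t) := fun j =>
    mul_nonneg (by positivity) (mul_nonneg (by positivity) (integral_pow_mul_legP_nonneg (by omega)))
  have htail_le := hasSum_le hterm_le h1 hgeom
  have htail_nonneg := hasSum_le hterm_nonneg hasSum_zero h1
  rw [abs_le]
  constructor <;> linarith [div_pos one_pos (by linarith : (0 : ℝ) < x - 1)]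

/-- **THE ASYMPTOTIC**: `x^{n+1} Q_n(x) → 1/((2n + 1) lc_n)` as `x → ∞`. -/
theorem tendsto_pow_mul_legQ2 (n : ℕ) :
    Tendsto (fun x => x ^ (n + 1) * legQ2 n x) atTop (𝓝 (1 / ((2 * (n : ℝ) + 1) * legLead n))) := by
  rw [Metric.tendsto_atTop]
  intro ε hε
  refine ⟨1 + 1 / ε + 1, fun x hx => ?_⟩
  have hx1 : 1 < x := by
    have : 0 < 1 / ε := by positivity
    linarith
  rw [Real.dist_eq]
  refine lt_of_le_of_lt (abs_pow_mul_legQ2_sub_le n hx1) ?_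
  have hpos : 0 < x - 1 := by linarith
  rw [div_lt_iff₀ hpos]
  have h1 : 1 / ε + 1 ≤ x - 1 := by linarith
  calc (1 : ℝ) < ε * (1 / ε + 1) := by
        rw [mul_add, mul_one_div_cancel hε.ne', mul_one]
        linarith
    _ ≤ ε * (x - 1) := mul_le_mul_of_nonneg_left h1 hε.le

/-- The classical constant: `1/((2n + 1) lc_n) = 2ⁿ (n!)²/(2n + 1)!`. -/
theorem inv_mul_legLead_eq (n : ℕ) :
    1 / ((2 * (n : ℝ) + 1) * legLead n) = 2 ^ n * (n.factorial : ℝ) ^ 2 / ((2 * n + 1).factorial : ℝ) := by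
  rw [legLead]
  have h1 : ((2 * n + 1).factorial : ℝ) = (2 * (n : ℝ) + 1) * ((2 * n).factorial : ℝ) := by
    rw [Nat.factorial_succ]
    push_cast
    ring
  rw [h1]
  have hne1 : ((2 * n).factorial : ℝ) ≠ 0 := by positivity
  have hne2 : (2 * (n : ℝ) + 1) ≠ 0 := by positivity
  have hne3 : (n.factorial : ℝ) ≠ 0 := by positivity
  field_simp

end Summit.Ventures.HodgeRepro2.T5SU11LegendreSecondKindSeries
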